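import Literature.NumberTheory.LFunctions.Zhang2022.DetectorEntangledCone

/-!
# Zhang (2022), programme F-S3 (cell landau-siegel, family B-det → §E row S-E-bdet-3): the LAYER-2 FENCE STATISTIC of
# shift and entangled detectors, and the kernel shape of LINE A of the E-102 discharge («positivity is inherited
# from the fence»)

Y. Zhang, *Discrete mean estimates and the Landau–Siegel zero*, arXiv:2211.02515v1 [Zhang2022LandauSiegel] — an
unrefereed manuscript under adjudication. **WHAT THIS IS NOT: not a claim about Theorems 1–2 of arXiv:2211.02515, about
Landau–Siegel zeros, or about Parity; nothing here asserts any claim of the manuscript, and nothing here asserts the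
registry row E-102 (`Det.EdetPremise (Set.Ioo 0 1) (Set.Ioo 0 5)`, file `DetectorEntangledCone`) or any limit
identity — every `Prop` below has explicit parameters (a predicate ON model data), stated, never asserted.**
«The programme SEARCHES and TYPES; no claim about Landau–Siegel zeros, Theorems 1–2 of arXiv:2211.02515 or a repaired
Margin232 until a kernel theorem says so.»

Cell documents this file serves (not literature): `B-det/plan/E102-DISCHARGE.md` v1.3 (sha16 0f9f14cb0f7e076d) §2 LINE A
and §5 (a) «typer-1: the LAYER-2 fence functional for SHIFT and ENTANGLED designs (`fenceShiftStat`, `fenceEntangledStat`,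
model weights, anchor-sign lemma …) — statement file, 0 facts»; the referee's costume/vacuity read REF-B1 2026-08-27T00:27:07Z
(traps (t1)–(t4), displayed below); theory ruling (c1) 2026-08-26T21:21:49Z (2)/(4) (the per-colouring closed form of the
model shift values, `F_S(b) = b·Π_{m∈S∖{0}}(1 − b/m)`; and (ii): the one-configuration lattice sum is NOT formula I — so the
limit identity is a CRUX, not bookkeeping); `DetectorClassDET` (LAYER-1 text: `Det.FenceModel`, the main-term-functional slot,
is a DIFFERENT object — a value of `MainTerm`; the statistic here is the discrete side).

## What is here

**Part 1 — the model shift values of the `κ = ½` fence, per colouring (theory (c1)(2)/(4)), and their two sign laws, PROVED.**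
In the LAYER-2 model the sampled zero `ρ` sits at site `0` of the `α`-lattice `½ + i(2πt₀ + mα)` and a COLOURING
`S ⊂ ℤ` records which sites are zeros of `L(s,ψ)` (the others being zeros of `L(s,ψχ)`); the model `M(·,ψ)` restricted to the
line vanishes exactly on `S`, so the normalised shifted value `x_b = M(ρ + iαb)/(iαM′(ρ))` is
`Det.colouringX S b = b·Π_{m ∈ S∖{0}}(1 − b/m)`. PROVED: the ANCHOR SIGN LAW `0 < colouringX S a` for `a ∈ (0,1)` and EVERY
colouring (`colouringX_pos_of_mem_Ioo` — the load-bearing sign of trap (t1): the first gap carries no site, `N_a = 0`), and the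
SHIFT-DETECTOR SIGN LAW `0 ≤ Π_j colouringX S (b j)` for every `Det.SignAdmissible b` and EVERY colouring
(`prod_colouringX_nonneg_of_signAdmissible` — the sub-gap shift is `≥ 0`, the in-gap pair has no site strictly between its
two shifts; this is the configuration-wise content of Lemma 2.3 / `Det.signAdmissible_iff_latticeSymbolNonpos`).

**Part 2 — fence data and the two fence statistics (the LAYER-2 functional as DATA; profiles complex-valued, trap (t3)).**
`Det.FenceData` packages, stage by stage (`D : ℕ`), a finite index set `Z D` of model sampling points, model weights
`w D ≥ 0` (the slot of `(iM′Y)²α³ω ≥ 0`), model shifted values `xv D b` with the anchor sign law as a FIELD (`0 ≤ xv D a` on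
`a ∈ (0,1)`), model Dirichlet-polynomial values `Av D g g′` of a profile with marked derivative (any complex profile), and ONE
normalisation `X D` with `0 < X D` eventually (trap (t4); the intended instance is Prop 7.1's unit `𝔞𝔓` —
`frakA χ * frakP D` in the skeleton — ONE scale for all `K²` blocks of an entangled design, the confluent blocks included, trap
(t2)). On such data: `FenceData.entangledStat` = `Det.entangledStat` of `DetectorEntangledCone` Part 4 (the statistic
`Ξ_{w·x_a}(u,u)`, `u = Σ_j x_{b_j}A_{h_j}`) and `FenceData.shiftStat` (the shift detector `Ξ_{w·x_{b₀}x_{b₁}x_{b₂}}(A_g,A_g)`), with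
`entangledStat_re_nonneg` (= the packet's `stub_fenceStat_nonneg`, PROVED from the two sign fields, hypothesis-free in the
profiles) and `shiftStat_re_nonneg` (given the shift sign law; `FenceData.SignFaithful` names «sign-admissible ⇒ model weight
`≥ 0`», PROVED for colouring data `FenceData.ofColouring` by Part 1). NO weights `w`, values `Av` or scale `X` are instantiated
here: by theory (c1)(ii) the literal one-configuration lattice sum × profile integral is NOT formula I, so WHICH model data
(if any) satisfy the limit identities of Part 3 is exactly the open crux of LINE A — this file does not pretend to know it.

**Part 3 — the limit identities as predicates ON fence data, and the compositions (kernel-checked, `≈ 10` lines each).**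
`FenceData.Limit F a b h h′` («`Re S(D)/X(D) → Re m(a;b;h)`», the packet's `stub_fenceLimit` — for the FULL double sum
`Det.entangledMain`, confluent blocks included, one `X`), `FenceData.LimitOn F A B` (for EVERY anchor in `A`, palette in `B`
and EVERY complex one-sided kinked top-vanishing profile vector — no smallness, no tabulated sub-class, trap (t3)),
`FenceData.ShiftLimit` / `ShiftLimitOn` (head 2: `Re S_b(D)/X(D) → FormDet (shiftRecipe b) g`, the packet's
`stub_fenceLimitMono`, distinct sign-admissible nodes). PROVED compositions (`Det.entangled_mainOrder_nonneg`):
`FenceData.conePSD_of_limit`, `FenceData.edetCone_of_limitOn` (head 1), `FenceData.formDetPSD_of_shiftLimit`,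
`FenceData.monomialConePSD_of_shiftLimitOn` (head 2), `FenceData.edetPremise_of_limits` and the row of record
`FenceData.edetPremise_unit_of_limits : F.SignFaithful → F.LimitOn (Ioo 0 1) (Ioo 0 5) → F.ShiftLimitOn (Ioo 0 5) →
Det.EdetPremise (Ioo 0 1) (Ioo 0 5)` — so the E-102 discharge `Det.edetPremise_unit` is EXACTLY «exhibit one `FenceData`
with the two limit properties» (LINE A), nothing more and nothing less. Model-free twins for ANY approximation scheme (LINE B
partial Gram sums, certificate ladders with a uniform modulus, …): `conePSD_of_tendsto_nonneg`, `formDetPSD_of_tendsto_nonneg`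
(a pointwise limit of non-negative reals is non-negative — `ge_of_tendsto'`).

0 named facts, 0 sorries; imports `DetectorEntangledCone` only; elementary throughout (tagged by the display whose object is
modelled; the real-variable lemmas are [folklore]).

## References

* Y. Zhang, arXiv:2211.02515v1 (2022), §2 (2.13)–(2.17), Lemma 2.3 p. 6 and its proof pp. 11–12, Prop. 2.2 (iii) p. 7;
  Prop 7.1 p. 44 with (7.2), (7.19)–(7.21); §8 (8.11)–(8.12); (2.31) (`𝔞`), (2.9) (`𝔓`). [cite: Zhang2022LandauSiegel, §2 Lemma 2.3 pp. 11–12; Prop 7.1 p. 44]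
* Cell documents (not literature): `B-det/plan/E102-DISCHARGE.md` v1.3 §§2, 5; REF-B1 read 2026-08-27T00:27:07Z (t1)–(t4); theory
  (c1) 2026-08-26T21:21:49Z; `B-det/KILL-draft.md` v2.2 §1 qualifier (b).
-/

noncomputable section

open Complex Real ComplexConjugate Filter Finset
open scoped Topology

namespace Literature.NumberTheory.LFunctions.Zhang2022

namespace Det

open Repair

/-! ### Part 1 — model shift values per colouring and their sign laws -/

/-- **The model shifted value of the `κ = ½` fence, per colouring** (theory ruling (c1) (2)/(4)): with the sampled zero at
site `0` and `S ⊂ ℤ` the set of sites of the `α`-lattice that are zeros of `L(s,ψ)`, the model `M` vanishes exactly on `S`, and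
`x_b = M(ρ+iαb)/(iαM′(ρ)) = b·Π_{m∈S∖{0}}(1 − b/m)` (site `0` is the sampled zero itself and is removed; `m = 0` would contribute
the factor `b`). [cite: Zhang2022LandauSiegel, §2 (2.13)–(2.15), Prop. 2.2 (iii) p. 7] -/
def colouringX (S : Finset ℤ) (b : ℝ) : ℝ := b * ∏ m ∈ S.erase 0, (1 - b / (m : ℝ))

/-- Unfolding. [cite: Zhang2022LandauSiegel, §2 (2.13)–(2.15)] -/
theorem colouringX_def (S : Finset ℤ) (b : ℝ) : colouringX S b = b * ∏ m ∈ S.erase 0, (1 - b / (m : ℝ)) := rfl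

/-- With no other `ψ`-site the model value is `b` itself (`M` linear through the sampled zero). [cite: Zhang2022LandauSiegel, §2 (2.13)–(2.15)] -/
theorem colouringX_empty (b : ℝ) : colouringX ∅ b = b := by simp [colouringX]

/-- A first-gap shift sees every site factor positive: `0 < 1 − a/m` for `0 ≤ a < 1` and every integer `m ≠ 0`
(`m ≥ 1`: `a/m ≤ a < 1`; `m ≤ −1`: `a/m ≤ 0`). [folklore] -/
private theorem one_sub_div_pos_of_lt_one {a : ℝ} (ha0 : 0 ≤ a) (ha1 : a < 1) {m : ℤ} (hm : m ≠ 0) :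
    0 < 1 - a / (m : ℝ) := by
  rcases lt_or_gt_of_ne hm with hneg | hpos
  · have hmR : (m : ℝ) < 0 := by exact_mod_cast hneg
    have : a / (m : ℝ) ≤ 0 := div_nonpos_of_nonneg_of_nonpos ha0 hmR.le
    linarith
  · have hmR : (1 : ℝ) ≤ m := by exact_mod_cast hpos
    have : a / (m : ℝ) ≤ a := div_le_self ha0 hmR
    linarith

/-- A sub-first-gap shift sees every site factor non-negative: `0 ≤ 1 − a/m` for `0 ≤ a ≤ 1`, `m ≠ 0`. [folklore] -/
private theorem one_sub_div_nonneg_of_le_one {a : ℝ} (ha0 : 0 ≤ a) (ha1 : a ≤ 1) {m : ℤ} (hm : m ≠ 0) :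
    0 ≤ 1 - a / (m : ℝ) := by
  rcases lt_or_gt_of_ne hm with hneg | hpos
  · have hmR : (m : ℝ) < 0 := by exact_mod_cast hneg
    have : a / (m : ℝ) ≤ 0 := div_nonpos_of_nonneg_of_nonpos ha0 hmR.le
    linarith
  · have hmR : (1 : ℝ) ≤ m := by exact_mod_cast hpos
    have : a / (m : ℝ) ≤ a := div_le_self ha0 hmR
    linarith

/-- **ANCHOR SIGN LAW (trap (t1), with its sign): `0 < x_a` for an anchor `a ∈ (0,1)` and EVERY colouring** — the first gap
`(0, α)` above the sampled zero carries no site (`N_a = 0`), so the anchor variable is positive configuration-wise.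
[cite: Zhang2022LandauSiegel, §2 Prop. 2.2 (iii) p. 7; proof of Lemma 2.3 p. 12] -/
theorem colouringX_pos_of_mem_Ioo (S : Finset ℤ) {a : ℝ} (ha : a ∈ Set.Ioo (0 : ℝ) 1) : 0 < colouringX S a :=
  mul_pos ha.1 (prod_pos fun _ hm => one_sub_div_pos_of_lt_one ha.1.le ha.2 (ne_of_mem_erase hm))

/-- `0 ≤ x_a` for `0 ≤ a ≤ 1` and every colouring (the closed first gap; `a = 1` with a site at `1` gives `x_1 = 0`).
[cite: Zhang2022LandauSiegel, §2 Prop. 2.2 (iii) p. 7; proof of Lemma 2.3 p. 12] -/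
theorem colouringX_nonneg_of_le_one (S : Finset ℤ) {a : ℝ} (ha0 : 0 ≤ a) (ha1 : a ≤ 1) : 0 ≤ colouringX S a :=
  mul_nonneg ha0 (prod_nonneg fun _ hm => one_sub_div_nonneg_of_le_one ha0 ha1 (ne_of_mem_erase hm))

/-- Two shifts in ONE closed unit gap `[k, k+1]` see every site on the same side: `0 ≤ (1 − x/m)(1 − y/m)` for every integer `m`
(`= (m − x)(m − y)/m²` for `m ≠ 0`, and no integer lies strictly between `x` and `y`). [folklore] -/
private theorem one_sub_div_mul_nonneg_of_gap {x y : ℝ} {k : ℤ} (hx : (k : ℝ) ≤ x) (hx' : x ≤ k + 1) (hy : (k : ℝ) ≤ y)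
    (hy' : y ≤ k + 1) (m : ℤ) : 0 ≤ (1 - x / (m : ℝ)) * (1 - y / (m : ℝ)) := by
  by_cases hm : m = 0
  · subst hm
    simp
  have hmR : (m : ℝ) ≠ 0 := by exact_mod_cast hm
  have hprod : 0 ≤ ((m : ℝ) - x) * ((m : ℝ) - y) := by
    rcases le_or_gt m k with hle | hgt
    · have hmk : (m : ℝ) ≤ k := by exact_mod_cast hle
      exact mul_nonneg_of_nonpos_of_nonpos (by linarith) (by linarith)
    · have hmk : (k : ℝ) + 1 ≤ m := by exact_mod_cast hgt
      exact mul_nonneg (by linarith) (by linarith)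
  have h1 : 1 - x / (m : ℝ) = ((m : ℝ) - x) / m := by field_simp
  have h2 : 1 - y / (m : ℝ) = ((m : ℝ) - y) / m := by field_simp
  rw [h1, h2, div_mul_div_comm]
  exact div_nonneg hprod (mul_self_nonneg _)

/-- **Pair-in-one-gap sign law**: for `0 ≤ x, y` in one closed unit gap `[k, k+1]` the product of the two model values is `≥ 0`
for EVERY colouring (`x_x·x_y = xy·Π_m (m − x)(m − y)/m²`). [cite: Zhang2022LandauSiegel, §2 proof of Lemma 2.3 p. 11 («`M(ρ+β₂)M(ρ+β₃) > 0`»)] -/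
theorem colouringX_mul_colouringX_nonneg_of_gap (S : Finset ℤ) {x y : ℝ} (hx0 : 0 ≤ x) (hy0 : 0 ≤ y) {k : ℤ}
    (hx : (k : ℝ) ≤ x) (hx' : x ≤ k + 1) (hy : (k : ℝ) ≤ y) (hy' : y ≤ k + 1) :
    0 ≤ colouringX S x * colouringX S y := by
  have hrw : colouringX S x * colouringX S y
      = (x * y) * ∏ m ∈ S.erase 0, ((1 - x / (m : ℝ)) * (1 - y / (m : ℝ))) := by
    rw [colouringX, colouringX, prod_mul_distrib]
    ring
  rw [hrw]
  exact mul_nonneg (mul_nonneg hx0 hy0) (prod_nonneg fun m _ => one_sub_div_mul_nonneg_of_gap hx hx' hy hy' m)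

/-- **SHIFT-DETECTOR SIGN LAW: for a sign-admissible triple `b` (`Det.SignAdmissible`: `0 < b₀ ≤ 1`, the pair `b₁ < b₂` in one
unit gap) the model weight factor `x_{b₀}x_{b₁}x_{b₂}` is `≥ 0` for EVERY colouring** — the configuration-wise content of Lemma 2.3
(`𝔠* ≥ 0`), i.e. the direction «admissible ⇒ non-negative on all patterns» of theory's all-patterns law (c4).
[cite: Zhang2022LandauSiegel, §2 Lemma 2.3 p. 6 and its proof pp. 11–12] -/
theorem prod_colouringX_nonneg_of_signAdmissible {b : Fin 3 → ℝ} (hb : SignAdmissible b) (S : Finset ℤ) :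
    0 ≤ ∏ j, colouringX S (b j) := by
  obtain ⟨h0, h01, h12, h0le, k, hk1, hk2⟩ := hb
  rw [Fin.prod_univ_three, mul_assoc]
  refine mul_nonneg (colouringX_nonneg_of_le_one S h0.le h0le) ?_
  have hb1 : 0 ≤ b 1 := (h0.trans h01).le
  have hb2 : 0 ≤ b 2 := ((h0.trans h01).trans h12).le
  have hk1' : ((k : ℤ) : ℝ) ≤ b 1 := by exact_mod_cast hk1
  have hk2' : b 2 ≤ ((k : ℤ) : ℝ) + 1 := by exact_mod_cast hk2
  exact colouringX_mul_colouringX_nonneg_of_gap S hb1 hb2 hk1' (by linarith) (by linarith) hk2'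

/-! ### Part 2 — fence data (the LAYER-2 functional as data) and the two fence statistics -/

/-- **Fence data** — the LAYER-2 model of the discrete side of a detector mean, stage by stage `D : ℕ`: a finite set `Z D` of
model sampling points (type `ι`), model weights `w D ≥ 0` (the slot of `(iM′Y)²α³ω`, real and `≥ 0`), model shifted values
`xv D b` (`b` the shift multiple) satisfying the ANCHOR SIGN LAW `0 ≤ xv D a` on `a ∈ (0,1)` (trap (t1): carried with its sign),
model Dirichlet-polynomial values `Av D g g′` of a COMPLEX profile `g` with marked derivative `g′` (trap (t3): no restriction on
the profile), and ONE normalisation `X D`, eventually positive (traps (t2), (t4); intended instance: the unit `𝔞𝔓` of Prop 7.1,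
`frakA χ * frakP D`, one scale for every block of an entangled design, confluent blocks included). Nothing in this structure says
which data are «the» fence; it is the parameter space over which LINE A quantifies.
[cite: Zhang2022LandauSiegel, §2 (2.15)–(2.17), Prop 7.1 p. 44] -/
structure FenceData where
  /-- the type of model sampling points -/
  ι : Type
  /-- the sampled points at stage `D` -/
  Z : ℕ → Finset ι
  /-- the model weight (`(iM′Y)²α³ω`-slot) -/
  w : ℕ → ι → ℝ
  /-- the model shifted values `x_b` -/
  xv : ℕ → ℝ → ι → ℝ
  /-- the model values `A_g` of a profile `g` with marked derivative `g′` -/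
  Av : ℕ → (ℝ → ℂ) → (ℝ → ℂ) → ι → ℂ
  /-- the normalisation `X(D)` (one for all blocks) -/
  X : ℕ → ℝ
  /-- the weight is `≥ 0` -/
  w_nonneg : ∀ D, ∀ ρ ∈ Z D, 0 ≤ w D ρ
  /-- ANCHOR SIGN LAW: `x_a ≥ 0` for `a ∈ (0,1)` -/
  xv_anchor_nonneg : ∀ D, ∀ a ∈ Set.Ioo (0 : ℝ) 1, ∀ ρ ∈ Z D, 0 ≤ xv D a ρ
  /-- the normalisation is eventually positive -/
  X_pos : ∀ᶠ D in atTop, 0 < X D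

namespace FenceData

variable (F : FenceData) {K : ℕ}

/-- **The fence statistic of an ENTANGLED design** `(a; b; h)` at stage `D`: `Ξ_{w·x_a}(u,u)` with `u = Σ_j x_{b_j}A_{h_j}` over the
model points (`Det.entangledStat` on the fence data). [cite: Zhang2022LandauSiegel, §2 (2.15)–(2.17)] -/
def entangledStat (a : ℝ) (b : Fin K → ℝ) (h h' : Fin K → ℝ → ℂ) (D : ℕ) : ℂ :=
  Det.entangledStat (F.Z D) (F.w D) (F.xv D a) (fun j => F.xv D (b j)) (fun j => F.Av D (h j) (h' j))

/-- Unfolding. [cite: Zhang2022LandauSiegel, §2 (2.15)–(2.17)] -/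
theorem entangledStat_eq (a : ℝ) (b : Fin K → ℝ) (h h' : Fin K → ℝ → ℂ) (D : ℕ) :
    F.entangledStat a b h h' D
      = Det.entangledStat (F.Z D) (F.w D) (F.xv D a) (fun j => F.xv D (b j)) (fun j => F.Av D (h j) (h' j)) := rfl

/-- **`stub_fenceStat_nonneg`, PROVED: the entangled fence statistic is `≥ 0` at EVERY stage, for an anchor `a ∈ (0,1)`, every
palette and every complex profile vector** — weight `≥ 0` times anchor value `≥ 0` (t1, with its sign) times a square
(`Det.entangledStat_re_nonneg`); no sign pattern on the palette, no hypothesis on the profiles.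
[cite: Zhang2022LandauSiegel, §2 (2.16), Lemma 2.3 p. 6] -/
theorem entangledStat_re_nonneg {a : ℝ} (ha : a ∈ Set.Ioo (0 : ℝ) 1) (b : Fin K → ℝ) (h h' : Fin K → ℝ → ℂ) (D : ℕ) :
    0 ≤ (F.entangledStat a b h h' D).re :=
  Det.entangledStat_re_nonneg (F.Z D) (F.w_nonneg D) (fun ρ hρ => F.xv_anchor_nonneg D a ha ρ hρ) _ _

/-- Its imaginary part vanishes. [cite: Zhang2022LandauSiegel, §2 (2.16)] -/
theorem entangledStat_im (a : ℝ) (b : Fin K → ℝ) (h h' : Fin K → ℝ → ℂ) (D : ℕ) :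
    (F.entangledStat a b h h' D).im = 0 :=
  Det.entangledStat_im (F.Z D) _ _ _ _

/-- **The fence statistic of a SHIFT detector** with shift triple `b` on the profile `g`: the discrete form with weight
`w·x_{b₀}x_{b₁}x_{b₂}` on the single test family `A_g` (the model of `Σ_ρ (iM′)²α³·x_{b₀}x_{b₁}x_{b₂}·|A_g|²·ω`, i.e. of
`Σ_ρ 𝔠*_b(ρ,ψ)|A_g(ρ,ψ)|²ω(ρ)` up to the positive normalisation of `𝔠*_b = Π_jM(ρ+β_j)/(iM′(ρ))` by `(iM′)²α³`).
[cite: Zhang2022LandauSiegel, §2 (2.15)–(2.16)] -/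
def shiftStat (b : Fin 3 → ℝ) (g g' : ℝ → ℂ) (D : ℕ) : ℂ :=
  discreteForm (F.Z D) (fun ρ => F.w D ρ * ∏ j, F.xv D (b j) ρ) (F.Av D g g') (F.Av D g g')

/-- Unfolding. [cite: Zhang2022LandauSiegel, §2 (2.15)–(2.16)] -/
theorem shiftStat_eq (b : Fin 3 → ℝ) (g g' : ℝ → ℂ) (D : ℕ) :
    F.shiftStat b g g' D = discreteForm (F.Z D) (fun ρ => F.w D ρ * ∏ j, F.xv D (b j) ρ) (F.Av D g g') (F.Av D g g') := rfl

/-- The shift fence statistic is `≥ 0` at a stage where the model weight factor `x_{b₀}x_{b₁}x_{b₂}` is `≥ 0` on the sampled points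
(for sign-admissible `b` and colouring data this holds at every stage: `SignFaithful`, `ofColouring_signFaithful`).
[cite: Zhang2022LandauSiegel, §2 (2.16), Lemma 2.3 p. 6] -/
theorem shiftStat_re_nonneg {b : Fin 3 → ℝ} {D : ℕ} (hb : ∀ ρ ∈ F.Z D, 0 ≤ ∏ j, F.xv D (b j) ρ) (g g' : ℝ → ℂ) :
    0 ≤ (F.shiftStat b g g' D).re :=
  discreteForm_self_nonneg (fun ρ hρ => mul_nonneg (F.w_nonneg D ρ hρ) (hb ρ hρ)) _

/-- Its imaginary part vanishes. [cite: Zhang2022LandauSiegel, §2 (2.16)] -/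
theorem shiftStat_im (b : Fin 3 → ℝ) (g g' : ℝ → ℂ) (D : ℕ) : (F.shiftStat b g g' D).im = 0 :=
  discreteForm_self_im _ _ _

/-- **«Sign-admissible ⇒ model weight `≥ 0`» for the fence data** (`Det.SignAdmissible` = the Lemma-2.3 shape; for colouring
data a theorem, `ofColouring_signFaithful`). A predicate ON the data. [cite: Zhang2022LandauSiegel, §2 Lemma 2.3 p. 6] -/
def SignFaithful (F : FenceData) : Prop :=
  ∀ b : Fin 3 → ℝ, SignAdmissible b → ∀ D, ∀ ρ ∈ F.Z D, 0 ≤ ∏ j, F.xv D (b j) ρ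

/-- On sign-faithful data the shift statistic of a sign-admissible triple is `≥ 0` at every stage (`stub_fenceStatMono_nonneg`).
[cite: Zhang2022LandauSiegel, §2 (2.16), Lemma 2.3 p. 6] -/
theorem SignFaithful.shiftStat_re_nonneg {F : FenceData} (hF : F.SignFaithful) {b : Fin 3 → ℝ} (hb : SignAdmissible b)
    (g g' : ℝ → ℂ) (D : ℕ) : 0 ≤ (F.shiftStat b g g' D).re :=
  F.shiftStat_re_nonneg (hF b hb D) g g'

end FenceData

/-- **Fence data with COLOURING-MODEL shift values**: sampling points carry a colouring `S ⊂ ℤ` (second component; the first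
component `κ` is any bookkeeping label — site, character, …) and `x_b = colouringX S b`; weights, Dirichlet-polynomial values
and the scale are free data. The anchor sign law is then the theorem `colouringX_pos_of_mem_Ioo`.
[cite: Zhang2022LandauSiegel, §2 (2.13)–(2.17), Prop. 2.2 (iii) p. 7] -/
def FenceData.ofColouring (κ : Type) (Z : ℕ → Finset (κ × Finset ℤ)) (w : ℕ → κ × Finset ℤ → ℝ)
    (Av : ℕ → (ℝ → ℂ) → (ℝ → ℂ) → κ × Finset ℤ → ℂ) (X : ℕ → ℝ) (hw : ∀ D, ∀ ρ ∈ Z D, 0 ≤ w D ρ)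
    (hX : ∀ᶠ D in atTop, 0 < X D) : FenceData where
  ι := κ × Finset ℤ
  Z := Z
  w := w
  xv := fun _ b ρ => colouringX ρ.2 b
  Av := Av
  X := X
  w_nonneg := hw
  xv_anchor_nonneg := fun _ _ ha ρ _ => (colouringX_pos_of_mem_Ioo ρ.2 ha).le
  X_pos := hX

/-- The shifted values of colouring data are the colouring model values. [cite: Zhang2022LandauSiegel, §2 (2.13)–(2.15)] -/
theorem FenceData.ofColouring_xv (κ : Type) (Z : ℕ → Finset (κ × Finset ℤ)) (w : ℕ → κ × Finset ℤ → ℝ)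
    (Av : ℕ → (ℝ → ℂ) → (ℝ → ℂ) → κ × Finset ℤ → ℂ) (X : ℕ → ℝ) (hw : ∀ D, ∀ ρ ∈ Z D, 0 ≤ w D ρ)
    (hX : ∀ᶠ D in atTop, 0 < X D) (D : ℕ) (b : ℝ) (ρ : κ × Finset ℤ) :
    (FenceData.ofColouring κ Z w Av X hw hX).xv D b ρ = colouringX ρ.2 b := rfl

/-- **Colouring data are sign-faithful** (Part 1's shift-detector sign law, every colouring).
[cite: Zhang2022LandauSiegel, §2 Lemma 2.3 p. 6 and its proof pp. 11–12] -/
theorem FenceData.ofColouring_signFaithful (κ : Type) (Z : ℕ → Finset (κ × Finset ℤ)) (w : ℕ → κ × Finset ℤ → ℝ)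
    (Av : ℕ → (ℝ → ℂ) → (ℝ → ℂ) → κ × Finset ℤ → ℂ) (X : ℕ → ℝ) (hw : ∀ D, ∀ ρ ∈ Z D, 0 ≤ w D ρ)
    (hX : ∀ᶠ D in atTop, 0 < X D) : (FenceData.ofColouring κ Z w Av X hw hX).SignFaithful :=
  fun _ hb _ ρ _ => prod_colouringX_nonneg_of_signAdmissible hb ρ.2

/-! ### Part 3 — the limit identities as predicates on fence data; the compositions -/

namespace FenceData

variable (F : FenceData) {K : ℕ}

/-- **`stub_fenceLimit` as a predicate ON the fence data (head 1): «`Re S(D)/X(D) → Re m(a;b;h)`»** — the normalised entangled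
fence statistic converges to the FULL block main-term form `Det.entangledMain a b h h′` (every block `(j,l)`, confluent ones by the
dd-recipe, ONE scale `X` — trap (t2)). THE CRUX of LINE A; OPEN (which data satisfy it is not known; theory (c1)(ii): not the
literal lattice sum); stated, never asserted. [cite: Zhang2022LandauSiegel, Prop 7.1 p. 44 with (7.19)–(7.21), (8.11)–(8.12)] -/
def Limit (a : ℝ) (b : Fin K → ℝ) (h h' : Fin K → ℝ → ℂ) : Prop :=
  Tendsto (fun D => (F.entangledStat a b h h' D).re / F.X D) atTop (𝓝 (entangledMain a b h h').re)

/-- **Head 1's limit property ON an anchor set `A` and a shift box `B`**: the limit identity for EVERY anchor `a ∈ A`, every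
finite palette in `B` and EVERY complex one-sided kinked top-vanishing profile vector (`Repair.KinkedProfile`, `h_j(1) = 0`; no
smallness or support condition — trap (t3)). [cite: Zhang2022LandauSiegel, Prop 7.1 p. 44 with (7.2), (7.19)–(7.21)] -/
def LimitOn (A B : Set ℝ) : Prop :=
  ∀ (K : ℕ) (a : ℝ), a ∈ A → ∀ b : Fin K → ℝ, (∀ j, b j ∈ B) →
    ∀ h h' : Fin K → ℝ → ℂ, (∀ j, KinkedProfile (h j) (h' j)) → (∀ j, h j 1 = 0) → F.Limit a b h h'

/-- **`stub_fenceLimitMono` as a predicate ON the fence data (head 2): «`Re S_b(D)/X(D) → 𝔅_{R(b)}(g)`»** — the normalised shift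
fence statistic converges to formula I's diagonal form `Det.FormDet (Det.shiftRecipe b) g g′` (distinct nodes). OPEN; stated,
never asserted. [cite: Zhang2022LandauSiegel, Prop 7.1 p. 44 with (7.19)–(7.21), (8.11)–(8.12)] -/
def ShiftLimit (b : Fin 3 → ℝ) (g g' : ℝ → ℂ) : Prop :=
  Tendsto (fun D => (F.shiftStat b g g' D).re / F.X D) atTop (𝓝 (FormDet (shiftRecipe b) g g'))

/-- **Head 2's limit property ON a shift box `B`**: the shift limit identity for every SIGN-ADMISSIBLE triple with entries in `B`
and every complex one-sided kinked top-vanishing profile. [cite: Zhang2022LandauSiegel, Prop 7.1 p. 44 with (7.2); §2 Lemma 2.3 p. 6] -/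
def ShiftLimitOn (B : Set ℝ) : Prop :=
  ∀ b : Fin 3 → ℝ, SignAdmissible b → (∀ j, b j ∈ B) →
    ∀ g g' : ℝ → ℂ, KinkedProfile g g' → g 1 = 0 → F.ShiftLimit b g g'

/-- **COMPOSITION, head 1, one member (`conePSD_of_fence`)**: if the fence data satisfy the limit identity at the anchor
`a ∈ (0,1)` and palette `b` for every admissible profile vector, then `BigF(a;b) ⪰ 0` on the profile class — a statistic `≥ 0` at
every stage (t1), normalised by an eventually positive scale (t4), cannot tend to a negative constant
(`Det.entangled_mainOrder_nonneg`). [cite: Zhang2022LandauSiegel, §2 (2.16), Prop 7.1 p. 44 with (7.2)] -/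
theorem conePSD_of_limit {a : ℝ} (ha : a ∈ Set.Ioo (0 : ℝ) 1) {b : Fin K → ℝ}
    (hlim : ∀ h h' : Fin K → ℝ → ℂ, (∀ j, KinkedProfile (h j) (h' j)) → (∀ j, h j 1 = 0) → F.Limit a b h h') :
    ConePSD a b := by
  intro h h' hk h1
  exact entangled_mainOrder_nonneg (Eventually.of_forall fun D => F.entangledStat_re_nonneg ha b h h' D) F.X_pos
    (hlim h h' hk h1)

/-- **COMPOSITION, head 1, the row**: fence data with the limit property on `A × B`, `A ⊆ (0,1)`, discharge `Det.EdetCone A B`.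
[cite: Zhang2022LandauSiegel, §2 (2.16), Prop 7.1 p. 44 with (7.2)] -/
theorem edetCone_of_limitOn {A B : Set ℝ} (hA : A ⊆ Set.Ioo (0 : ℝ) 1) (h : F.LimitOn A B) : EdetCone A B :=
  fun K _ ha b hb => F.conePSD_of_limit (hA ha) (h K _ ha b hb)

/-- Head 1, row of record: `F.LimitOn (0,1) (0,5) → Det.EdetCone (0,1) (0,5)` (the packet's `edetCone_unit` modulo the crux).
[cite: Zhang2022LandauSiegel, §2 (2.16), Prop 7.1 p. 44 with (7.2)] -/
theorem edetCone_unit_of_limitOn (h : F.LimitOn (Set.Ioo 0 1) (Set.Ioo 0 5)) : EdetCone (Set.Ioo 0 1) (Set.Ioo 0 5) :=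
  F.edetCone_of_limitOn subset_rfl h

/-- **COMPOSITION, head 2, one member**: if the model weight factor of `b` is `≥ 0` at every stage and the shift limit identity holds
for every admissible profile, then `𝔅_{R(b)} ⪰ 0` on one-sided kinked profiles (`Det.FormDetPSD (Det.shiftRecipe b)`).
[cite: Zhang2022LandauSiegel, §2 (2.16), Lemma 2.3 p. 6, Prop 7.1 p. 44 with (7.2)] -/
theorem formDetPSD_of_shiftLimit {b : Fin 3 → ℝ} (hsign : ∀ D, ∀ ρ ∈ F.Z D, 0 ≤ ∏ j, F.xv D (b j) ρ)
    (hlim : ∀ g g' : ℝ → ℂ, KinkedProfile g g' → g 1 = 0 → F.ShiftLimit b g g') :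
    FormDetPSD (shiftRecipe b) := by
  intro g g' hg hg1
  exact entangled_mainOrder_nonneg (Eventually.of_forall fun D => F.shiftStat_re_nonneg (hsign D) g g') F.X_pos
    (hlim g g' hg hg1)

/-- **COMPOSITION, head 2, the row**: sign-faithful fence data with the shift limit property on the box `B` discharge
`Det.MonomialConePSD B` (the packet's `monomialConePSD_unit` modulo the crux, at `B = (0,5)`).
[cite: Zhang2022LandauSiegel, §2 (2.16), Lemma 2.3 p. 6, Prop 7.1 p. 44 with (7.2)] -/
theorem monomialConePSD_of_shiftLimitOn (hF : F.SignFaithful) {B : Set ℝ} (h : F.ShiftLimitOn B) :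
    MonomialConePSD B :=
  fun b hb hB => F.formDetPSD_of_shiftLimit (hF b hb) (h b hb hB)

/-- **COMPOSITION, both heads**: sign-faithful fence data with both limit properties discharge the full premise
`Det.EdetPremise A B` (`A ⊆ (0,1)`). [cite: Zhang2022LandauSiegel, §2 (2.16), Lemma 2.3 p. 6, Prop 7.1 p. 44 with (7.2)] -/
theorem edetPremise_of_limits (hF : F.SignFaithful) {A B : Set ℝ} (hA : A ⊆ Set.Ioo (0 : ℝ) 1) (h1 : F.LimitOn A B)
    (h2 : F.ShiftLimitOn B) : EdetPremise A B :=
  ⟨F.edetCone_of_limitOn hA h1, F.monomialConePSD_of_shiftLimitOn hF h2⟩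

/-- **LINE A IN ONE SENTENCE (row of record)**: the E-102 discharge `Det.EdetPremise (0,1) (0,5)` follows from ONE sign-faithful
`FenceData` with the head-1 limit property on `(0,1) × (0,5)` and the head-2 limit property on `(0,5)` — nothing more is needed and
(by this file) nothing less is typed. Until such data are exhibited every citation of the B-det word keeps «GIVEN E-102».
[cite: Zhang2022LandauSiegel, §2 (2.16), Lemma 2.3 p. 6, Prop 7.1 p. 44 with (7.2), (7.19)–(7.21)] -/
theorem edetPremise_unit_of_limits (hF : F.SignFaithful) (h1 : F.LimitOn (Set.Ioo 0 1) (Set.Ioo 0 5))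
    (h2 : F.ShiftLimitOn (Set.Ioo 0 5)) : EdetPremise (Set.Ioo 0 1) (Set.Ioo 0 5) :=
  F.edetPremise_of_limits hF subset_rfl h1 h2

end FenceData

/-! ### Model-free twins: any scheme of non-negative approximants (LINE B partial Gram sums, uniform certificate ladders, …) -/

/-- **A cone member from ANY non-negative approximation scheme**: if for every admissible profile vector the real number
`Re m(a;b;h)` is a limit of non-negative reals, then `BigF(a;b) ⪰ 0` on the class. [cite: Zhang2022LandauSiegel, Prop 7.1 p. 44 with (7.2)] -/
theorem conePSD_of_tendsto_nonneg {a : ℝ} {K : ℕ} {b : Fin K → ℝ}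
    (hS : ∀ h h' : Fin K → ℝ → ℂ, (∀ j, KinkedProfile (h j) (h' j)) → (∀ j, h j 1 = 0) →
      ∃ S : ℕ → ℝ, (∀ n, 0 ≤ S n) ∧ Tendsto S atTop (𝓝 (entangledMain a b h h').re)) :
    ConePSD a b := by
  intro h h' hk h1
  obtain ⟨S, hS0, hT⟩ := hS h h' hk h1
  exact ge_of_tendsto' hT hS0

/-- **A monomial member from ANY non-negative approximation scheme**: if for every admissible profile `𝔅_R(g)` is a limit of
non-negative reals, then `Det.FormDetPSD R`. [cite: Zhang2022LandauSiegel, Prop 7.1 p. 44 with (7.2)] -/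
theorem formDetPSD_of_tendsto_nonneg {R : DetRecipe}
    (h : ∀ g g' : ℝ → ℂ, KinkedProfile g g' → g 1 = 0 →
      ∃ S : ℕ → ℝ, (∀ n, 0 ≤ S n) ∧ Tendsto S atTop (𝓝 (FormDet R g g'))) :
    FormDetPSD R := by
  intro g g' hg hg1
  obtain ⟨S, hS0, hT⟩ := h g g' hg hg1
  exact ge_of_tendsto' hT hS0

end Det

end Literature.NumberTheory.LFunctions.Zhang2022
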